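import Mathlib
import Summits.NavierStokesRegularity.NavierStokesRegularity.Theorems.ExactWindowRungThreeTransferBootstrap
import Summits.NavierStokesRegularity.NavierStokesRegularity.Theses.PicardRadiiRungThree
import HarnessLib

/-!
# `PicardRadiiRungThree.TransferBootstrap` = `ExactWindowRungThree.TransferBootstrap`
  (item stmt-NavierStokesRegularity-23564, re-wanted verbatim by route `PicardRadiiRungThree`)

The support `TransferBootstrap` of route `PicardRadiiRungThree` is, character for character, the
support `TransferBootstrap` of route `ExactWindowRungThree` (item stmt-NavierStokesRegularity-22416),
proved in the tree as `exactWindowRungThree_transferBootstrap_proof` (file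
`ExactWindowRungThreeTransferBootstrap.lean`: shadowing transfer K1a ⇒ K1 composed with the
trapping bootstrap K1 → K2 → RobustStep). Both route files spell `ExactFlowCertificate` and
`TailEnvelopes` with identical bodies, so the new item is closed by unfolding and `exact`.

HONEST FRAMING: MODEL lattice bookkeeping (Tao-type table); nothing about Navier–Stokes.
-/

noncomputable section

set_option linter.dupNamespace false

namespace Summit.NavierStokesRegularity.NavierStokesRegularity.Theorems

/-- **Item stmt-NavierStokesRegularity-23564** (`PicardRadiiRungThree.TransferBootstrap`):
`ExactFlowCertificate → TailEnvelopes → RobustStep data at ε₀ = 1`, closed by the tree theorem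
`exactWindowRungThree_transferBootstrap_proof` (identical bodies). [cite: Tao2016AveragedNS, §6.4 Prop. 6.5] -/
theorem picardRadiiRungThree_transferBootstrap_proof :
    Summit.NavierStokesRegularity.NavierStokesRegularity.Theses.PicardRadiiRungThree.TransferBootstrap := by
  have h := exactWindowRungThree_transferBootstrap_proof
  unfold Summit.NavierStokesRegularity.NavierStokesRegularity.Theses.ExactWindowRungThree.TransferBootstrap
    Summit.NavierStokesRegularity.NavierStokesRegularity.Theses.ExactWindowRungThree.ExactFlowCertificate
    Summit.NavierStokesRegularity.NavierStokesRegularity.Theses.ExactWindowRungThree.TailEnvelopes at h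
  unfold Summit.NavierStokesRegularity.NavierStokesRegularity.Theses.PicardRadiiRungThree.TransferBootstrap
    Summit.NavierStokesRegularity.NavierStokesRegularity.Theses.PicardRadiiRungThree.ExactFlowCertificate
    Summit.NavierStokesRegularity.NavierStokesRegularity.Theses.PicardRadiiRungThree.TailEnvelopes
  exact h

end Summit.NavierStokesRegularity.NavierStokesRegularity.Theorems

end
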